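import Summits.Ventures.PercRepro.PuncturedLYMTwoCoHyp

/-!
# PercRepro — TWO DISJOINT CO-HYPERPLANES, PART 2: THE MASTER LEMMA (p10, gen 34)

* `aOf_add_aOf_le_card`, `card_le_aOf_add_aOf` — the realisable profiles `(a, b)` of a set against two disjoint sets:
  `a + b ≤ #Z ≤ a + b + (n − #C₁ − #C₂)`;
* **`puncturedNMP_two_of_seq`** — three nonnegative sequences in two indices with row sums `1` and column sums `#P/#Y`
  on the realisable profiles give `PuncturedNMP j (upLevel j C₁ ∪ upLevel j C₂)` for disjoint `C₁, C₂` with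
  `#C₁ + #C₂ ≥ j + 2` — the master lemma of gen 33 (`puncturedNMP_upLevel_of_seq`) with one more index.
The sequences (the boundary-corrected superposition of proofs/P10-BOUNDARY-g34.md §2′) are NOT constructed here;
nothing asserts (SP), (PAV) or (NC).
-/

namespace PercRepro.PuncturedLYM

open Finset

variable {α : Type} [Fintype α] [DecidableEq α]

omit [Fintype α] in
/-- The profile of a finset against two disjoint sets: `a + b ≤ #Z` with `a = #(Z ∩ C₁)`, `b = #(Z ∩ C₂)`. -/
theorem aOf_add_aOf_le_card {C₁ C₂ Z : Finset α} (hdisj : Disjoint C₁ C₂) : aOf C₁ Z + aOf C₂ Z ≤ Z.card := by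
  have d : Disjoint (Z ∩ C₁) (Z ∩ C₂) := hdisj.mono inter_subset_right inter_subset_right
  have e : (Z ∩ C₁) ∪ (Z ∩ C₂) = Z ∩ (C₁ ∪ C₂) := (inter_union_distrib_left Z C₁ C₂).symm
  have h := card_union_of_disjoint d
  rw [e] at h
  have := card_le_card (inter_subset_left (s₁ := Z) (s₂ := C₁ ∪ C₂))
  unfold aOf
  omega

/-- The profile of a finset against two disjoint sets: `#Z ≤ a + b + (n − #C₁ − #C₂)`. -/
theorem card_le_aOf_add_aOf {C₁ C₂ Z : Finset α} (hdisj : Disjoint C₁ C₂) :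
    Z.card ≤ aOf C₁ Z + aOf C₂ Z + (Fintype.card α - C₁.card - C₂.card) := by
  have d : Disjoint (Z ∩ C₁) (Z ∩ C₂) := hdisj.mono inter_subset_right inter_subset_right
  have e : (Z ∩ C₁) ∪ (Z ∩ C₂) = Z ∩ (C₁ ∪ C₂) := (inter_union_distrib_left Z C₁ C₂).symm
  have h := card_union_of_disjoint d
  rw [e] at h
  have h2 := card_sdiff_add_card_inter Z (C₁ ∪ C₂)
  have h3 : (Z \ (C₁ ∪ C₂)).card ≤ (univ \ (C₁ ∪ C₂)).card := card_le_card (sdiff_subset_sdiff (subset_univ Z) subset_rfl)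
  rw [card_univ_sdiff, card_union_of_disjoint hdisj] at h3
  unfold aOf
  omega

/-- **(SP) for `upLevel j C₁ ∪ upLevel j C₂` from three sequences** (`C₁, C₂` disjoint, `#C₁ + #C₂ ≥ j + 2`,
`j < n`; `m₁ = #C₁`, `m₂ = #C₂`, `ρ = n − m₁ − m₂`): nonnegative on `a < m₁`, `b < m₂`; row sums `1` on the realisable
profiles (`a + b ≤ j ≤ a + b + ρ`); column sums `k = #P/#Y` on the realisable `(j+1)`-profiles:
`a'·wA (a' − 1) b' + b'·wB a' (b' − 1) + (j + 1 − a' − b')·wR a' b' = k` (`a' < m₁`, `b' < m₂`),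
`m₁·wA (m₁ − 1) b' = k` (`b' < m₂`), `m₂·wB a' (m₂ − 1) = k` (`a' < m₁`). -/
theorem puncturedNMP_two_of_seq {j : ℕ} {C₁ C₂ : Finset α} (hjn : j < Fintype.card α) (hdisj : Disjoint C₁ C₂)
    (hbig : j + 2 ≤ C₁.card + C₂.card) (wA wB wR : ℕ → ℕ → ℚ) (k : ℚ)
    (hk : k * (levelAbove α j).card = (punctured j (upLevel j C₁ ∪ upLevel j C₂)).card)
    (hnn : ∀ a b, a < C₁.card → b < C₂.card → 0 ≤ wA a b ∧ 0 ≤ wB a b ∧ 0 ≤ wR a b)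
    (hrow : ∀ a b, a < C₁.card → b < C₂.card → a + b ≤ j →
      j ≤ a + b + (Fintype.card α - C₁.card - C₂.card) →
      ((C₁.card : ℚ) - a) * wA a b + ((C₂.card : ℚ) - b) * wB a b +
        ((Fintype.card α : ℚ) - j - C₁.card - C₂.card + a + b) * wR a b = 1)
    (hcol : ∀ a' b', a' < C₁.card → b' < C₂.card → a' + b' ≤ j + 1 →
      j + 1 ≤ a' + b' + (Fintype.card α - C₁.card - C₂.card) →
      (a' : ℚ) * wA (a' - 1) b' + (b' : ℚ) * wB a' (b' - 1) + ((j : ℚ) + 1 - a' - b') * wR a' b' = k)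
    (htop₁ : ∀ b', b' < C₂.card → C₁.card + b' ≤ j + 1 →
      j + 1 ≤ C₁.card + b' + (Fintype.card α - C₁.card - C₂.card) → (C₁.card : ℚ) * wA (C₁.card - 1) b' = k)
    (htop₂ : ∀ a', a' < C₁.card → a' + C₂.card ≤ j + 1 →
      j + 1 ≤ a' + C₂.card + (Fintype.card α - C₁.card - C₂.card) → (C₂.card : ℚ) * wB a' (C₂.card - 1) = k) :
    PuncturedNMP j (upLevel j C₁ ∪ upLevel j C₂) := by
  intro 𝒜 h𝒜
  rcases Nat.eq_zero_or_pos (punctured j (upLevel j C₁ ∪ upLevel j C₂)).card with hP | hP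
  · have : 𝒜 = ∅ := subset_empty.1 (card_eq_zero.1 hP ▸ h𝒜)
    subst this
    simp
  have hYpos : (0 : ℚ) < (levelAbove α j).card := by exact_mod_cast card_levelAbove_pos hjn
  have hPpos : (0 : ℚ) < (punctured j (upLevel j C₁ ∪ upLevel j C₂)).card := by exact_mod_cast hP
  have hkpos : 0 < k := by
    by_contra h
    push Not at h
    have : k * (levelAbove α j).card ≤ 0 := mul_nonpos_of_nonpos_of_nonneg h hYpos.le
    linarith
  refine puncturedNMP_of_weights (fun X Y => hW2p wA wB wR C₁ C₂ X Y / k) ?_ ?_ ?_ 𝒜 h𝒜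
  · -- nonnegativity
    intro X hX Y hY
    obtain ⟨hXc, hC1, hC2⟩ := mem_punctured_union_upLevel.1 hX
    rw [sups_eq hXc] at hY
    obtain ⟨y, hy, rfl⟩ := mem_image.1 hY
    rw [hW2p_insert wA wB wR C₁ C₂ X (mem_sdiff.1 hy).2]
    apply div_nonneg _ hkpos.le
    unfold hW2
    have ha := aOf_lt_card hC1
    have hb := aOf_lt_card hC2
    split_ifs
    · exact (hnn _ _ ha hb).1
    · exact (hnn _ _ ha hb).2.1
    · exact (hnn _ _ ha hb).2.2
  · -- row sums
    intro X hX
    obtain ⟨hXc, hC1, hC2⟩ := mem_punctured_union_upLevel.1 hX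
    have hab := aOf_add_aOf_le_card (Z := X) hdisj
    have hab' := card_le_aOf_add_aOf (Z := X) hdisj
    rw [hXc] at hab hab'
    rw [← sum_div, sum_sups_hW2 wA wB wR hdisj hXc, hrow _ _ (aOf_lt_card hC1) (aOf_lt_card hC2) hab hab']
    rw [div_le_div_iff₀ hPpos hkpos, one_mul, ← hk]
    exact le_of_eq (mul_comm _ _)
  · -- column sums
    intro Y hY
    rw [mem_levelAbove] at hY
    rw [← sum_div, div_le_one hkpos]
    have hab := aOf_add_aOf_le_card (Z := Y) hdisj
    have hab' := card_le_aOf_add_aOf (Z := Y) hdisj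
    rw [hY] at hab hab'
    have hnot : ¬ (C₁ ⊆ Y ∧ C₂ ⊆ Y) := by
      rintro ⟨h1, h2⟩
      have := card_le_card (union_subset h1 h2)
      rw [card_union_of_disjoint hdisj, hY] at this
      omega
    by_cases h1 : C₁ ⊆ Y
    · have h2 : ¬ C₂ ⊆ Y := fun h2 => hnot ⟨h1, h2⟩
      rw [sum_subsP_hW2_top₁ wA wB wR hdisj hY h1 h2]
      have hY1 : aOf C₁ Y = C₁.card := by
        unfold aOf
        rw [inter_eq_right.2 h1]
      rw [hY1] at hab hab'
      exact le_of_eq (htop₁ _ (aOf_lt_card h2) hab hab')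
    · by_cases h2 : C₂ ⊆ Y
      · rw [sum_subsP_hW2_top₂ wA wB wR hdisj hY h1 h2]
        have hY2 : aOf C₂ Y = C₂.card := by
          unfold aOf
          rw [inter_eq_right.2 h2]
        rw [hY2] at hab hab'
        exact le_of_eq (htop₂ _ (aOf_lt_card h1) hab hab')
      · rw [sum_subsP_hW2_untouched wA wB wR hdisj hY h1 h2]
        exact le_of_eq (hcol _ _ (aOf_lt_card h1) (aOf_lt_card h2) hab hab')

end PercRepro.PuncturedLYM
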